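import Summits.Parity.GeneralizedHardyLittlewood.Theorems.LeeYangFibresRelativeDimOneFloatingDefs
import Summits.Parity.GeneralizedHardyLittlewood.Theorems.LeeYangFibresRelativeDimOneTypeClassMoments
import HarnessLib

/-!
# Type-class moving moments at FLOATING level from the flat class second moment: the registered stub
`stub_typeClassMomentsFlat` (crux stmt-Parity-14113 `LeeYangFibres.RelativeDimOne`, line floating-level-core)

`stub_typeClassMomentsFlat : LowClassSecondMomentFlat → TypeClassMomentsFlat`.

Proof. A RE-THREAD, pointwise in the accuracy, of the two landed proofs
`classVariance_of_lowClassSecondMoment` (`…SplitClassVariance.lean`) and `TCM.typeClassMoments_of_pos`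
(`…TypeClassMoments.lean`), every helper reused BY NAME.
* `classVarianceAt_of_lowClassSecondMomentAt`: the class variance `Σ_a (ψ(x;q,a) − 1_{(a,q)=1} x/φ(q))² ≤ ε x²/φ(q)`
  for `q ≤ x^{θ₁}`, `x ≥ x₀`, from the class second moment at the SINGLE accuracy `ε/6` (the landed body calls
  its hypothesis once, at `ε/6`).
* the stub: given `(t, L, δ, ε)` the Brun–Titchmarsh constant is taken at level `1/2`
  (`classPsi_le_of_level (1/2)`, serving every level `θ₁ ≤ 1/2` since `q ≤ x^{θ₁} ≤ x^{1/2}`), so that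
  `Lr, Cb, ε₁, ε₂` are level-free; THEN the flat hypothesis at accuracy `ε₁/6` supplies a level `θ > 0` and a
  threshold, the level is shrunk to `θ₁ = min θ (1/2)` (`lowClassSecondMomentAt_level_mono`), and the landed body
  runs verbatim at output level `θ₁/2`.
-/

noncomputable section

open scoped BigOperators Classical Topology ArithmeticFunction.vonMangoldt
open Finset Filter Literature.NumberTheory.Sieve
open Summit.Parity.GeneralizedHardyLittlewood.Cruxes.RelativeDimOne.GallagherBackwards (classPsi classPsi_nonneg)
open Summit.Parity.GeneralizedHardyLittlewood.Cruxes.RelativeDimOne.GallagherBackwardsSplit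
open Summit.Parity.GeneralizedHardyLittlewood.Cruxes.RelativeDimOne.GallagherBackwardsSplit.ClassVariance
open Summit.Parity.GeneralizedHardyLittlewood.Cruxes.RelativeDimOne.GallagherBackwardsSplit.BrunTitchmarshAP
  (exists_nat_of_eventually)
open Summit.Parity.GeneralizedHardyLittlewood.Cruxes.RelativeDimOne.TypeSplit
open Summit.Parity.GeneralizedHardyLittlewood.Cruxes.RelativeDimOne.TypeSplit.TCM

namespace Summit.Parity.GeneralizedHardyLittlewood.Cruxes.RelativeDimOne.FloatingLevelCore

/-- **Class variance from the class second moment at ONE accuracy.** For `θ₁ < 1` and `ε > 0`, the class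
second moment at level `θ₁`, accuracy `ε/6` and threshold `N₁` implies: there is `x₀` such that for all
naturals `x ≥ x₀` and all moduli `1 ≤ q ≤ x^{θ₁}`,
`∑_{a < q} (ψ(x;q,a) − 1_{(a,q)=1} · x/φ(q))² ≤ ε x²/φ(q)` (the body of the landed
`classVariance_of_lowClassSecondMoment`, whose hypothesis is consumed once, at `ε/6`). -/
theorem classVarianceAt_of_lowClassSecondMomentAt {θ₁ : ℝ} (hθ : θ₁ < 1) {ε : ℝ} (hε : 0 < ε) {N₁ : ℕ}
    (hN₁ : LowClassSecondMomentAt θ₁ (ε / 6) N₁) :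
    ∃ x₀ : ℕ, ∀ x : ℕ, x₀ ≤ x → ∀ q : ℕ, 1 ≤ q → (q : ℝ) ≤ (x : ℝ) ^ θ₁ →
      ∑ a ∈ Finset.range q, (classPsi x q a - if a.Coprime q then (x : ℝ) / Nat.totient q else 0) ^ 2 ≤
        ε * (x : ℝ) ^ 2 / Nat.totient q := by
  -- adapted from `classVariance_of_lowClassSecondMoment` (…SplitClassVariance.lean)
  set ε' : ℝ := ε / 6 with hε'
  have hε'0 : 0 < ε' := by positivity
  obtain ⟨N₂, hN₂⟩ := exists_pnt_lower hε'0
  obtain ⟨N₃, hN₃⟩ := exists_nat_of_eventually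
    ((ClassVariance.eventually_junk_le hθ (by positivity : (0 : ℝ) ≤ 1 + ε')
      (by positivity : (0 : ℝ) < ε / 2)).and (eventually_ge_atTop (2 : ℝ)))
  refine ⟨max N₁ (max N₂ N₃), fun x hx q hq hqx => ?_⟩
  have hx1 : N₁ ≤ x := le_trans (le_max_left _ _) hx
  have hx2 : N₂ ≤ x := le_trans ((le_max_left _ _).trans (le_max_right _ _)) hx
  have hx3 : N₃ ≤ x := le_trans ((le_max_right _ _).trans (le_max_right _ _)) hx
  obtain ⟨hjunk, hx2'⟩ := hN₃ x hx3
  have hx0 : (0 : ℝ) < x := by linarith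
  have hxge1 : (1 : ℝ) ≤ x := by linarith
  have hq0 : 0 < q := hq
  have hφ0 : (0 : ℝ) < Nat.totient q := by exact_mod_cast Nat.totient_pos.2 hq0
  have hφq : (Nat.totient q : ℝ) ≤ q := by exact_mod_cast Nat.totient_le q
  -- `q ≤ x`
  have hqx' : (q : ℝ) ≤ x := by
    refine hqx.trans ?_
    have := Real.rpow_le_rpow_of_exponent_le hxge1 hθ.le
    rwa [Real.rpow_one] at this
  have hqxN : q ≤ x := by exact_mod_cast hqx'
  -- abbreviations
  set φ : ℝ := (Nat.totient q : ℝ) with hφdef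
  set M : ℝ := (x : ℝ) / φ with hM
  set S2 : ℝ := ∑ a ∈ range q, classPsi x q a ^ 2 with hS2
  set S1 : ℝ := ∑ a ∈ range q, (if a.Coprime q then classPsi x q a else 0) with hS1
  set ψx : ℝ := ∑ n ∈ Icc 1 x, (Λ n : ℝ) with hψx
  set B : ℝ := ∑ n ∈ (Icc 1 x).filter (fun n => ¬ n.Coprime q), (Λ n : ℝ) with hB
  -- expansion of the square
  have hexp : ∑ a ∈ range q, (classPsi x q a - if a.Coprime q then (x : ℝ) / Nat.totient q else 0) ^ 2
      = S2 - 2 * M * S1 + M ^ 2 * φ := by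
    have hpt : ∀ a ∈ range q,
        (classPsi x q a - if a.Coprime q then (x : ℝ) / Nat.totient q else 0) ^ 2 =
          classPsi x q a ^ 2 - 2 * M * (if a.Coprime q then classPsi x q a else 0) +
            M ^ 2 * (if a.Coprime q then (1 : ℝ) else 0) := by
      intro a _
      split_ifs <;> simp only [hM, hφdef] <;> ring
    rw [sum_congr rfl hpt, sum_add_distrib, sum_sub_distrib, ← mul_sum, ← mul_sum,
      sum_indicator_coprime]
  -- the three inputs
  have hS2le : S2 ≤ (1 + ε') * ((x : ℝ) ^ 2 / φ + x * Real.log x) := hN₁ x hx1 q hq hqx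
  have hS1eq : S1 = ψx - B := by
    rw [hS1, sum_classPsi_coprime x q hq0, hψx, hB, eq_sub_iff_add_eq]
    exact Finset.sum_filter_add_sum_filter_not _ _ _
  have hψlow : (1 - ε') * x ≤ ψx := hN₂ x hx2
  have hBle : B ≤ 4 * Real.log x ^ 3 := sum_vonMangoldt_not_coprime_le hq0 hqxN
  have hM0 : 0 ≤ M := by positivity
  have hlogx : 0 ≤ Real.log x := Real.log_natCast_nonneg x
  -- junk control: `(1+ε') φ log x + 8 log³ x ≤ (ε/2) x`
  have hjunk' : (1 + ε') * φ * Real.log x + 8 * Real.log x ^ 3 ≤ ε / 2 * x := by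
    have hφx : φ ≤ (x : ℝ) ^ θ₁ := hφq.trans hqx
    have : (1 + ε') * φ * Real.log x ≤ (1 + ε') * (x : ℝ) ^ θ₁ * Real.log x := by
      apply mul_le_mul_of_nonneg_right _ hlogx
      exact mul_le_mul_of_nonneg_left hφx (by positivity)
    linarith
  -- assemble
  rw [hexp, hS1eq]
  have hkey : (1 + ε') * (x * Real.log x) + 2 * M * B ≤ ε / 2 * (x : ℝ) ^ 2 / φ := by
    have h1 : 2 * M * B ≤ 2 * M * (4 * Real.log x ^ 3) := by nlinarith
    have h2 : (1 + ε') * (x * Real.log x) + 2 * M * (4 * Real.log x ^ 3) =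
        (x / φ) * ((1 + ε') * φ * Real.log x + 8 * Real.log x ^ 3) := by
      rw [hM]; field_simp; ring
    have h3 : (x / φ) * ((1 + ε') * φ * Real.log x + 8 * Real.log x ^ 3) ≤ (x / φ) * (ε / 2 * x) :=
      mul_le_mul_of_nonneg_left hjunk' hM0
    have h4 : (x / φ) * (ε / 2 * x) = ε / 2 * (x : ℝ) ^ 2 / φ := by field_simp
    linarith
  have hmain : S2 - 2 * M * (ψx - B) + M ^ 2 * φ ≤
      3 * ε' * (x : ℝ) ^ 2 / φ + ((1 + ε') * (x * Real.log x) + 2 * M * B) := by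
    have h1 : 2 * M * ((1 - ε') * x) ≤ 2 * M * ψx :=
      mul_le_mul_of_nonneg_left hψlow (by positivity)
    have h2 : M ^ 2 * φ = (x : ℝ) ^ 2 / φ := by rw [hM]; field_simp
    have h3 : 2 * M * ((1 - ε') * x) = 2 * (1 - ε') * ((x : ℝ) ^ 2 / φ) := by rw [hM]; field_simp
    have h4 : S2 - 2 * M * (ψx - B) + M ^ 2 * φ =
        S2 - 2 * M * ψx + 2 * M * B + (x : ℝ) ^ 2 / φ := by rw [← h2]; ring
    have h5 : (1 + ε') * ((x : ℝ) ^ 2 / φ + x * Real.log x) =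
        ((x : ℝ) ^ 2 / φ) + ε' * ((x : ℝ) ^ 2 / φ) + (1 + ε') * (x * Real.log x) := by ring
    have h6 : 3 * ε' * (x : ℝ) ^ 2 / φ = 3 * (ε' * ((x : ℝ) ^ 2 / φ)) := by ring
    rw [h4, h6]
    rw [h5] at hS2le
    rw [h3] at h1
    linarith
  calc S2 - 2 * M * (ψx - B) + M ^ 2 * φ
      ≤ 3 * ε' * (x : ℝ) ^ 2 / φ + ((1 + ε') * (x * Real.log x) + 2 * M * B) := hmain
    _ ≤ 3 * ε' * (x : ℝ) ^ 2 / φ + ε / 2 * (x : ℝ) ^ 2 / φ := by linarith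
    _ = ε * (x : ℝ) ^ 2 / φ := by rw [hε']; ring

/-- **`stub_typeClassMomentsFlat`** (registered stub of the line floating-level-core, crux stmt-Parity-14113):
the flat class second moment `LowClassSecondMomentFlat` (level chosen after the accuracy) implies the flat
type-class moving moments `TypeClassMomentsFlat`. Re-thread of `TCM.typeClassMoments_of_pos` with the
Brun–Titchmarsh constant at level `1/2`, the level supplied by the hypothesis at the single accuracy `ε₁/6`,
shrunk to `θ₁ ≤ 1/2`, output level `θ₁/2`. -/
theorem stub_typeClassMomentsFlat : LowClassSecondMomentFlat → TypeClassMomentsFlat := by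
  intro hLflat t L ht δ ε hδ hε
  -- adapted from `TCM.typeClassMoments_of_pos` (…TypeClassMoments.lean)
  -- constants (level-free: Brun–Titchmarsh at level `1/2`)
  obtain ⟨C, hC, x₀B, hBT⟩ := classPsi_le_of_level (1 / 2) (by norm_num)
  obtain ⟨Lr, hLr⟩ : ∃ Lr : ℝ, Lr = max (L : ℝ) 1 := ⟨_, rfl⟩
  have hLr1 : 1 ≤ Lr := by rw [hLr]; exact le_max_right _ _
  have hLLr : (L : ℝ) ≤ Lr := by rw [hLr]; exact le_max_left _ _
  have hLr0 : 0 < Lr := by linarith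
  obtain ⟨Cb, hCb⟩ : ∃ Cb : ℝ, Cb = C * Lr / δ + 1 := ⟨_, rfl⟩
  have hCb0 : 0 < Cb := by rw [hCb]; positivity
  obtain ⟨ε₁, hε₁⟩ : ∃ ε₁ : ℝ, ε₁ = ε * δ ^ 2 / (16 * 2 ^ t * Cb ^ t * Lr ^ 2) := ⟨_, rfl⟩
  obtain ⟨ε₂, hε₂⟩ : ∃ ε₂ : ℝ, ε₂ = ε * δ / (12 * 2 ^ t * Cb ^ t * Lr) := ⟨_, rfl⟩
  have hε₁0 : 0 < ε₁ := by rw [hε₁]; positivity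
  have hε₂0 : 0 < ε₂ := by rw [hε₂]; positivity
  have hE1 : 2 ^ t * (C * Lr / δ + 1) ^ t * (4 * ε₁ * Lr ^ 2 / δ ^ 2) ≤ ε / 4 := by
    rw [← hCb, hε₁]; apply le_of_eq; field_simp; ring
  have hE2 : 2 ^ t * (C * Lr / δ + 1) ^ t * (3 * ε₂ * Lr / δ) ≤ ε / 4 := by
    rw [← hCb, hε₂]; apply le_of_eq; field_simp; ring
  -- the level: from the flat hypothesis at accuracy `ε₁/6`, shrunk to `≤ 1/2`
  obtain ⟨θ, hθpos, NL, hAt⟩ := hLflat (ε₁ / 6) (div_pos hε₁0 (by norm_num))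
  obtain ⟨θ₁, hθ₁def⟩ : ∃ θ₁ : ℝ, θ₁ = min θ (1 / 2) := ⟨_, rfl⟩
  have hθ0 : 0 < θ₁ := by rw [hθ₁def]; exact lt_min hθpos (by norm_num)
  have hθhalf : θ₁ ≤ 1 / 2 := by rw [hθ₁def]; exact min_le_right _ _
  have hθ₁ : θ₁ < 1 := by linarith
  have hAt₁ : LowClassSecondMomentAt θ₁ (ε₁ / 6) NL :=
    lowClassSecondMomentAt_level_mono hθ0 (by rw [hθ₁def]; exact min_le_left _ _) hAt
  obtain ⟨x₀V, hV⟩ := classVarianceAt_of_lowClassSecondMomentAt hθ₁ hε₁0 hAt₁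
  obtain ⟨x₀P, hP⟩ := two_sided_pnt hε₂0
  -- the output level `θ₁' = θ₁/2`
  obtain ⟨θ₁', hθ'def⟩ : ∃ θ₁' : ℝ, θ₁' = θ₁ / 2 := ⟨_, rfl⟩
  have hθ' : θ₁' < θ₁ := by rw [hθ'def]; linarith
  have hθ'0 : 0 < θ₁' := by rw [hθ'def]; positivity
  refine ⟨θ₁', hθ'0, ?_⟩
  -- thresholds (eventually in real `x`)
  have hδθ : 0 < δ ^ θ₁ := Real.rpow_pos_of_pos hδ θ₁
  have ev1 := eventually_rpow_le_mul_rpow hθ' hδθ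
  have ev2 := eventually_logpow_junk_le hθ₁ (A := 2 ^ t * Cb ^ t) (c := ε / 2 * δ) (by positivity)
    (by positivity) hLr1 t
  have ev3 := eventually_logpow_junk_le hθ₁ (A := 1) (c := δ) zero_le_one hδ hLr1 0
  have ev4 := eventually_logpow_junk_le (θ := 0) zero_lt_one (A := 1) (c := ε₂ * Lr) zero_le_one
    (by positivity) hLr1 0
  have ev5 : ∀ᶠ x : ℝ in atTop, (max (x₀B : ℝ) (max (x₀V : ℝ) (x₀P : ℝ)) + 2 : ℝ) ≤ δ * x :=
    (tendsto_id.const_mul_atTop hδ).eventually_ge_atTop _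
  obtain ⟨N₁, hN₁⟩ := exists_nat_of_eventually (ev1.and (ev2.and (ev3.and (ev4.and ev5))))
  refine ⟨max N₁ 1, ?_⟩
  intro N hN q hq _ hqN a b₀ u _ X hX W _ hwin
  obtain ⟨h1, h2, h3, h4, h5⟩ := hN₁ N (le_of_max_le_left hN)
  simp only [pow_zero, mul_one, one_mul, Real.rpow_zero] at h3 h4
  -- basic facts on `N`, `q`
  have hN1 : (1 : ℝ) ≤ N := by exact_mod_cast le_of_max_le_right hN
  have hN0 : (0 : ℝ) < N := by linarith
  have hq0 : (0 : ℝ) < q := by exact_mod_cast hq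
  have hqθ : (q : ℝ) ≤ (N : ℝ) ^ θ₁ := hqN.trans (Real.rpow_le_rpow_of_exponent_le hN1 hθ'.le)
  have hqNr : (q : ℝ) ≤ N := by
    refine hqθ.trans ?_
    have := Real.rpow_le_rpow_of_exponent_le hN1 hθ₁.le
    rwa [Real.rpow_one] at this
  have hmax0 : (0 : ℝ) ≤ max (x₀B : ℝ) (max (x₀V : ℝ) (x₀P : ℝ)) :=
    le_trans (Nat.cast_nonneg _) (le_max_left _ _)
  have hδN2 : 2 ≤ δ * N := by linarith
  have hδN0 : 0 ≤ δ * N := by linarith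
  have hqδN : (q : ℝ) ≤ (δ * N) ^ θ₁ := by
    rw [Real.mul_rpow hδ.le hN0.le]; exact hqN.trans h1
  have hqδN' : (q : ℝ) ≤ δ * N := by
    refine hqδN.trans ?_
    have := Real.rpow_le_rpow_of_exponent_le (by linarith : 1 ≤ δ * N) hθ₁.le
    rwa [Real.rpow_one] at this
  have hx₀B : (x₀B : ℝ) ≤ δ * N := by linarith [le_max_left (x₀B : ℝ) (max (x₀V : ℝ) (x₀P : ℝ))]
  have hx₀V : (x₀V : ℝ) ≤ δ * N := by
    linarith [le_max_right (x₀B : ℝ) (max (x₀V : ℝ) (x₀P : ℝ)), le_max_left (x₀V : ℝ) (x₀P : ℝ)]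
  have hx₀P : (x₀P : ℝ) ≤ δ * N := by
    linarith [le_max_right (x₀B : ℝ) (max (x₀V : ℝ) (x₀P : ℝ)), le_max_right (x₀V : ℝ) (x₀P : ℝ)]
  have hLrN1 : 1 ≤ Lr * N := by nlinarith
  -- the junk level `J₀ = 4 log³(Lr N)` and its thresholds
  obtain ⟨J₀, hJ₀⟩ : ∃ J₀ : ℝ, J₀ = 4 * Real.log (Lr * N) ^ 3 := ⟨_, rfl⟩
  have hlog0 : 0 ≤ Real.log (Lr * N) := Real.log_nonneg hLrN1
  have hJ00 : 0 ≤ J₀ := by rw [hJ₀]; positivity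
  have hJ1 : J₀ * q ≤ δ * N := by
    have hNθ : 0 ≤ (N : ℝ) ^ θ₁ := Real.rpow_nonneg hN0.le _
    calc J₀ * q ≤ J₀ * (N : ℝ) ^ θ₁ := mul_le_mul_of_nonneg_left hqθ hJ00
      _ = (N : ℝ) ^ θ₁ * (4 * Real.log (Lr * N) ^ 3) := by rw [hJ₀]; ring
      _ ≤ δ * N := h3
  have hJ2 : J₀ ≤ ε₂ * Lr * N := by rw [hJ₀]; linarith [h4]
  have hJ3 : 2 ^ t * (C * Lr / δ + 1) ^ t * ((q : ℝ) / Nat.totient q) ^ t * q * J₀ ≤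
      ε / 2 * δ * N := by
    rw [← hCb]
    have hr : (q : ℝ) / Nat.totient q ≤ Real.logb 2 N + 1 := by
      calc _ ≤ (Nat.log 2 q : ℝ) + 1 := self_div_totient_le q hq
        _ ≤ Real.logb 2 q + 1 := by
            have := Real.natLog_le_logb q 2
            push_cast at this
            linarith
        _ ≤ Real.logb 2 N + 1 := by
            have := Real.logb_le_logb_of_le (b := 2) one_lt_two hq0 hqNr
            linarith
    have hr0 : 0 ≤ (q : ℝ) / Nat.totient q := by positivity
    have hNθ : 0 ≤ (N : ℝ) ^ θ₁ := Real.rpow_nonneg hN0.le _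
    have hlb1 : 0 ≤ Real.logb 2 N + 1 := by
      have := Real.logb_nonneg (b := 2) one_lt_two hN1
      linarith
    have hpow : ((q : ℝ) / Nat.totient q) ^ t ≤ (Real.logb 2 N + 1) ^ t := pow_le_pow_left₀ hr0 hr t
    have h2C : (0 : ℝ) ≤ 2 ^ t * Cb ^ t := by positivity
    calc 2 ^ t * Cb ^ t * ((q : ℝ) / Nat.totient q) ^ t * q * J₀
        ≤ 2 ^ t * Cb ^ t * (Real.logb 2 N + 1) ^ t * (N : ℝ) ^ θ₁ * J₀ := by
          apply mul_le_mul_of_nonneg_right _ hJ00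
          exact mul_le_mul (mul_le_mul_of_nonneg_left hpow h2C) hqθ hq0.le
            (mul_nonneg h2C (pow_nonneg hlb1 t))
      _ = 2 ^ t * Cb ^ t * (Real.logb 2 N + 1) ^ t * (N : ℝ) ^ θ₁ * (4 * Real.log (Lr * N) ^ 3) := by
          rw [hJ₀]
      _ ≤ ε / 2 * δ * N := h2
  -- the bound at one position `n < W` of the windows
  have key2 : ∀ n ∈ range W,
      |∑ c ∈ typeCell q q a b₀,
          ∏ i, (classPsi (a i * n + u i + X i).toNat q (resid q (a i * n + c i)) -
            classPsi (a i * n + u i - 1).toNat q (resid q (a i * n + c i))) -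
        (∏ i, ((X i : ℝ) + 1)) / (Nat.totient q : ℝ) ^ t *
          (((typeCell q q a b₀).filter (fun c => ∀ i, Nat.Coprime (c i) q)).card : ℝ)| ≤
      ε * (∏ i, ((X i : ℝ) + 1)) *
        ((((typeCell q q a b₀).filter (fun c => ∀ i, Nat.Coprime (c i) q)).card : ℝ) /
            (Nat.totient q : ℝ) ^ t + ((typeCell q q a b₀).card : ℝ) / (q : ℝ) ^ t) := by
    intro n hn
    rw [Finset.mem_range] at hn
    -- translate the cell
    rw [sum_typeCell_transl hq a b₀ (n : ℤ) (fun c => ∏ i,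
      (classPsi (a i * n + u i + X i).toNat q (c i) - classPsi (a i * n + u i - 1).toNat q (c i)))]
    -- the heights `lo = (a n + u − 1).toNat`, `hi = (a n + u + X).toNat` (`window_heights`)
    have hw : ∀ i, (a i * n + u i - 1).toNat ≤ (a i * n + u i + X i).toNat ∧
        δ * N ≤ (((a i * n + u i - 1).toNat : ℕ) : ℝ) ∧
        (((a i * n + u i + X i).toNat : ℕ) : ℝ) ≤ Lr * N ∧
        (((a i * n + u i + X i).toNat : ℕ) : ℝ) - (((a i * n + u i - 1).toNat : ℕ) : ℝ) = (X i : ℝ) + 1 :=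
      fun i => window_heights hδN0 hN0.le hLLr (hwin i n hn).1 (hwin i n hn).2
    have hlo_ge : ∀ i, δ * N ≤ (((a i * n + u i - 1).toNat : ℕ) : ℝ) := fun i => (hw i).2.1
    have hhi_le : ∀ i, (((a i * n + u i + X i).toNat : ℕ) : ℝ) ≤ Lr * N := fun i => (hw i).2.2.1
    have hhi_ge : ∀ i, δ * N ≤ (((a i * n + u i + X i).toNat : ℕ) : ℝ) :=
      fun i => (hlo_ge i).trans (by exact_mod_cast (hw i).1)
    have hqlo : ∀ i, q ≤ (a i * n + u i - 1).toNat := fun i => by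
      have : (q : ℝ) ≤ (((a i * n + u i - 1).toNat : ℕ) : ℝ) := hqδN'.trans (hlo_ge i)
      exact_mod_cast this
    -- level: `q ≤ x^{θ₁} ≤ x^{1/2}` at both heights
    have hlev : ∀ x : ℕ, δ * N ≤ (x : ℝ) → (q : ℝ) ≤ (x : ℝ) ^ θ₁ := fun x hx =>
      hqδN.trans (Real.rpow_le_rpow hδN0 hx hθ0.le)
    have hlev2 : ∀ x : ℕ, δ * N ≤ (x : ℝ) → (q : ℝ) ≤ (x : ℝ) ^ (1 / 2 : ℝ) := fun x hx =>
      (hlev x hx).trans (Real.rpow_le_rpow_of_exponent_le (by linarith) hθhalf)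
    have hthr : ∀ x x₀ : ℕ, (x₀ : ℝ) ≤ δ * N → δ * N ≤ (x : ℝ) → x₀ ≤ x := fun x x₀ h h' => by
      have : (x₀ : ℝ) ≤ x := h.trans h'
      exact_mod_cast this
    have key := cell_moment_bound q hq a b₀ (fun i => (a i * n + u i - 1).toNat)
      (fun i => (a i * n + u i + X i).toNat) (fun i => (X i : ℝ) + 1) N Lr δ ε C ε₁ ε₂ J₀ hN0 hLr1 hδ hε
      hC hε₁0 hε₂0 hJ00
      (fun i => (hw i).2.2.2) (fun i => by linarith [hX i]) (fun i => (hw i).1) hqlo hhi_le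
      (fun i r => hBT _ (hthr _ _ hx₀B (hhi_ge i)) q hq (hlev2 _ (hhi_ge i)) r)
      (fun i => hV _ (hthr _ _ hx₀V (hhi_ge i)) q hq (hlev _ (hhi_ge i)))
      (fun i => hV _ (hthr _ _ hx₀V (hlo_ge i)) q hq (hlev _ (hlo_ge i)))
      (fun i => hP _ (hthr _ _ hx₀P (hhi_ge i)))
      (fun i => hP _ (hthr _ _ hx₀P (hlo_ge i)))
      (fun i => by
        rw [hJ₀]
        have hpos : (0 : ℝ) < (((a i * n + u i + X i).toNat : ℕ) : ℝ) :=
          lt_of_lt_of_le (by linarith) (hhi_ge i)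
        have hl : Real.log (((a i * n + u i + X i).toNat : ℕ) : ℝ) ≤ Real.log (Lr * N) :=
          Real.log_le_log hpos (hhi_le i)
        have hl0 : 0 ≤ Real.log (((a i * n + u i + X i).toNat : ℕ) : ℝ) :=
          Real.log_nonneg (by linarith [hhi_ge i])
        gcongr)
      hJ1 hJ2 hJ3 hE1 hE2
    exact key
  -- summing over the positions
  rw [coprimePairs_eq_mul_card q hq a b₀ W, Nat.cast_mul]
  exact abs_sum_sub_le _ _ _ _ _ key2 (by ring) (by ring)

end Summit.Parity.GeneralizedHardyLittlewood.Cruxes.RelativeDimOne.FloatingLevelCore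

end
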